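import Summits.CriticalPhenomena.PercolationContinuityZ3.Theorems.PercNearOneGluingNoHeavyLowerTailUniformCertLeSix
import Summits.CriticalPhenomena.PercolationContinuityZ3.Theorems.PercNearOneGluingNoHeavyLowerTailHalfLeSevenForms

/-!
# `NoHeavyLowerTail` (crux stmt-CriticalPhenomena-4575 ≡ KN Conjecture 3), certificate programme:
# the crux's OWN lower-tail forms at EVERY uniform density on all simple graphs with at most six
# vertices

The crux bounds the lower tail of `N = |C(o) ∩ A|`.  Its two finitely-checkable linear proxies
(Disproof §D.1 of the crux's disprover, there derived instance-wise from `AdditiveGluing` for the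
SAME weights) are

* the HUB tail `P(o ↮ a₀, ∃ a ∈ A ∖ {a₀} : o ↔ a) ≤ η` whenever `a₀ ∈ A` and `P(a ↮ a₀) ≤ η` on `A`
  (`hubTail_uniform_le_six`);
* the LINEAR lower-tail form `P(1 ≤ N < EN/2) ≤ 3 · (P(o ↮ A) + η)` whenever
  `P(a ↮ a') ≤ η` on `A × A` (`linearLowerTail_uniform_le_six`).

Here the additive-gluing input is the kernel-checked window certificate
`additiveGluing_uniform_le_six` / `reachDiff_uniform_le_six` (`…UniformCertLeSix.lean`: every simple
graph on `Fin n`, `n ≤ 6`, Bernoulli bond percolation with EVERY density `p ∈ [0, 1]`), so both forms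
hold on that window unconditionally — in particular in the near-one regime.  The proofs are the
measure-generic ports of Disproof §D.1, line by line those of `…HalfLeSevenForms.lean` with
`half ↦ p`: the hub tail event lies in `{o ↔ A} ∖ {o ↔ a₀}` (`≤ η` by `reachDiff_uniform_le_six`
after `P(a ↮ a₀) ≤ η ↦ 1 − η ≤ P(a ↔ a₀)`); the linear form splits on `{o ↔ a₀}` — on it `N` is the
own count of `a₀` and first-moment counting (`uniformFormsLeSix_ownCount_lowerTail_le`, the
density-free version of `halfLeSevenForms_ownCount_lowerTail_le`) gives `≤ 2η` since `EN ≤ |A|`,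
off it the event lies in `{o ↔ A} ∖ {o ↔ a₀}` (`≤ η` by the hub form).

Nothing here asserts or refutes the crux.
-/

namespace Summit.CriticalPhenomena.PercolationContinuityZ3.Theorems

open MeasureTheory
open Literature.Probability.LatticeModels Literature.Probability.Percolation
open Summit.CriticalPhenomena.PercolationContinuityZ3.Theorems.AdditiveGluing.Negative.Cert

/-! ### Toolkit: first-moment counting of the own count, for any finite measure -/

open scoped Classical in
/-- **Counting bound for the own count of a reliable relay point** (any finite measure `μ` on bond
configurations of `Fin n`, e.g. `bondPercolation G p` for every density `p`). If `μ(a₀ ↮ a) ≤ η` for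
all `a ∈ A` then `(|A| − τ) · μ(#{a ∈ A : a₀ ↔ a} < τ) ≤ |A| · η`. [folklore] -/
theorem uniformFormsLeSix_ownCount_lowerTail_le {n : ℕ} (μ : Measure (Set (Sym2 (Fin n))))
    [IsFiniteMeasure μ] (A : Finset (Fin n)) (a₀ : Fin n) (η τ : ℝ)
    (hη : ∀ a ∈ A, μ.real (openConn a₀ a)ᶜ ≤ η) :
    ((A.card : ℝ) - τ) * μ.real
        {ω | ((A.filter fun a => ω ∈ openConn a₀ a).card : ℝ) < τ} ≤ A.card * η := by
  classical
  calc ((A.card : ℝ) - τ) * μ.real {ω | ((A.filter fun a => ω ∈ openConn a₀ a).card : ℝ) < τ}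
      ≤ ∑ a ∈ A, μ.real ({ω | ((A.filter fun a => ω ∈ openConn a₀ a).card : ℝ) < τ} ∩
          (openConn a₀ a)ᶜ) := by
        refine halfLeSevenForms_mul_measureReal_le_sum_inter μ A (fun a => (openConn a₀ a)ᶜ)
          (fun a _ => halfLeSevenForms_measurableSet_config _)
          (halfLeSevenForms_measurableSet_config _) _ fun ω hω => ?_
        rw [← halfLeSevenForms_card_filter_eq_sum_indicator]
        have hsplit := Finset.card_filter_add_card_filter_not (s := A) (fun a => ω ∈ openConn a₀ a)
        have hω' : ((A.filter fun a => ω ∈ openConn a₀ a).card : ℝ) < τ := hω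
        have hcast : ((A.filter fun a => ω ∈ openConn a₀ a).card : ℝ)
            + ((A.filter fun a => ¬ ω ∈ openConn a₀ a).card : ℝ) = A.card := by
          exact_mod_cast hsplit
        have : ((A.filter fun a => ω ∈ (openConn a₀ a)ᶜ).card : ℝ)
            = ((A.filter fun a => ¬ ω ∈ openConn a₀ a).card : ℝ) := rfl
        linarith
    _ ≤ ∑ a ∈ A, μ.real (openConn a₀ a)ᶜ :=
        Finset.sum_le_sum fun a _ => measureReal_mono Set.inter_subset_right
    _ ≤ ∑ a ∈ A, η := Finset.sum_le_sum fun a ha => hη a ha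
    _ = A.card * η := by simp

/-! ### The hub tail on the window `n ≤ 6`, every density -/

open Classical in
/-- **Hub tail of the lower tail (every density, at most six vertices).** For every simple graph `G`
on `Fin n`, `n ≤ 6`, under Bernoulli bond percolation with ANY density `p`: if `a₀ ∈ A` and
`P_p(a ↮ a₀) ≤ η` for all `a ∈ A`, then `o` misses `a₀` but meets some `a ∈ A ∖ {a₀}` with probability
at most `η` — the event lies in `{o ↔ A} ∖ {o ↔ a₀}`, bounded by the certificate
`reachDiff_uniform_le_six`. [folklore] -/
theorem hubTail_uniform_le_six : ∀ (n : ℕ), n ≤ 6 → ∀ (G : SimpleGraph (Fin n)) (p : unitInterval) (A : Finset (Fin n)) (o a₀ : Fin n) (η : ℝ), a₀ ∈ A → (∀ a ∈ A, (Literature.Probability.Percolation.bondPercolation G p).real (Literature.Probability.Percolation.openConn a a₀)ᶜ ≤ η) → (Literature.Probability.Percolation.bondPercolation G p).real {ω | ω ∉ Literature.Probability.Percolation.openConn o a₀ ∧ 1 ≤ ((A.erase a₀).filter fun a => ω ∈ Literature.Probability.Percolation.openConn o a).card} ≤ η := by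
  intro n hn G p A o a₀ η ha₀ hη
  have hdiff : (bondPercolation G p).real ((⋃ a ∈ A, openConn o a) \ openConn o a₀) ≤ η := by
    refine reachDiff_uniform_le_six hn G p A o a₀ η ha₀ fun a ha => ?_
    have := hη a ha
    rw [probReal_compl_eq_one_sub (halfLeSevenForms_measurableSet_config _)] at this
    linarith
  refine le_trans (measureReal_mono ?_ (measure_ne_top _ _)) hdiff
  intro ω hω
  simp only [Set.mem_setOf_eq] at hω
  obtain ⟨ho, h1⟩ := hω
  refine ⟨?_, ho⟩
  obtain ⟨a, ha⟩ := Finset.card_pos.1 h1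
  rw [Finset.mem_filter] at ha
  exact Set.mem_biUnion (Finset.mem_coe.2 (Finset.mem_of_mem_erase ha.1)) ha.2

/-! ### The linear lower-tail form on the window `n ≤ 6`, every density -/

open Classical in
/-- **Linear lower-tail form with constant `3` (every density, at most six vertices).** For every
simple graph `G` on `Fin n`, `n ≤ 6`, under Bernoulli bond percolation with ANY density `p`: if
`P_p(a ↮ a') ≤ η` for all `a, a' ∈ A` then, with `N = #{a ∈ A : o ↔ a}` and
`EN = ∑_{a ∈ A} P_p(o ↔ a)`, `P_p(1 ≤ N < EN/2) ≤ 3 · (P_p(o ↮ A) + η)` (even without the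
`P_p(o ↮ A)` term): `2η` from first-moment counting of the own count of a hub `a₀ ∈ A` on
`{o ↔ a₀}` (there `N = #{a ∈ A : a₀ ↔ a}` and `EN/2 ≤ |A|/2`), plus `η` from the hub form
`reachDiff_uniform_le_six` on `{o ↮ a₀}`. [folklore] -/
theorem linearLowerTail_uniform_le_six : ∀ (n : ℕ), n ≤ 6 → ∀ (G : SimpleGraph (Fin n)) (p : unitInterval) (A : Finset (Fin n)) (o : Fin n) (η : ℝ), 0 ≤ η → (∀ a ∈ A, ∀ a' ∈ A, (Literature.Probability.Percolation.bondPercolation G p).real (Literature.Probability.Percolation.openConn a a')ᶜ ≤ η) → (Literature.Probability.Percolation.bondPercolation G p).real {ω | 1 ≤ (A.filter fun a => ω ∈ Literature.Probability.Percolation.openConn o a).card ∧ ((A.filter fun a => ω ∈ Literature.Probability.Percolation.openConn o a).card : ℝ) < (∑ a ∈ A, (Literature.Probability.Percolation.bondPercolation G p).real (Literature.Probability.Percolation.openConn o a)) / 2} ≤ 3 * ((Literature.Probability.Percolation.bondPercolation G p).real (⋃ a ∈ A, Literature.Probability.Percolation.openConn o a)ᶜ + η) := by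
  intro n hn G p A o η hη0 hη
  set P := bondPercolation G p with hP
  rcases A.eq_empty_or_nonempty with hAe | ⟨a₀, ha₀⟩
  · subst hAe
    have : P.real {ω | 1 ≤ ((∅ : Finset (Fin n)).filter fun a => ω ∈ openConn o a).card ∧
        (((∅ : Finset (Fin n)).filter fun a => ω ∈ openConn o a).card : ℝ) <
          (∑ a ∈ (∅ : Finset (Fin n)), P.real (openConn o a)) / 2} ≤ P.real (∅ : Set _) :=
      measureReal_mono (fun ω hω => by simp at hω) (measure_ne_top _ _)
    simp only [measureReal_empty] at this
    have h0 : 0 ≤ P.real (⋃ a ∈ (∅ : Finset (Fin n)), openConn o a)ᶜ := measureReal_nonneg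
    nlinarith [this]
  set M : ℕ := A.card with hM
  set EN : ℝ := ∑ a ∈ A, P.real (openConn o a) with hEN
  have hENle : EN ≤ M := by
    calc EN ≤ ∑ a ∈ A, (1 : ℝ) := Finset.sum_le_sum fun a _ => measureReal_le_one
      _ = M := by simp [hM]
  have hMpos : (1 : ℝ) ≤ M := by exact_mod_cast Finset.card_pos.2 ⟨a₀, ha₀⟩
  let S₁ : Set (Set (Sym2 (Fin n))) :=
    {ω | ((A.filter fun a => ω ∈ openConn a₀ a).card : ℝ) < EN / 2}
  have hcount : ((M : ℝ) - EN / 2) * P.real S₁ ≤ M * η :=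
    uniformFormsLeSix_ownCount_lowerTail_le P A a₀ η (EN / 2) fun a ha => hη a₀ ha₀ a ha
  have hS₁ : P.real S₁ ≤ 2 * η := by
    have h2 : (M : ℝ) / 2 ≤ M - EN / 2 := by linarith
    have hle : (M : ℝ) * (1 / 2 * P.real S₁) ≤ M * η := by
      calc (M : ℝ) * (1 / 2 * P.real S₁) = M / 2 * P.real S₁ := by ring
        _ ≤ (M - EN / 2) * P.real S₁ := mul_le_mul_of_nonneg_right h2 measureReal_nonneg
        _ ≤ M * η := hcount
    have := le_of_mul_le_mul_left hle (by positivity)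
    linarith
  have hdiff : P.real ((⋃ a ∈ A, openConn o a) \ openConn o a₀) ≤ η := by
    refine reachDiff_uniform_le_six hn G p A o a₀ η ha₀ fun a ha => ?_
    have := hη a ha a₀ ha₀
    rw [probReal_compl_eq_one_sub (halfLeSevenForms_measurableSet_config _)] at this
    linarith
  have hUc : 0 ≤ P.real (⋃ a ∈ A, openConn o a)ᶜ := measureReal_nonneg
  refine le_trans (measureReal_mono (s₂ := ((⋃ a ∈ A, openConn o a) \ openConn o a₀) ∪ S₁)
    ?_ (measure_ne_top _ _)) ?_
  · intro ω hω
    simp only [Set.mem_setOf_eq] at hω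
    obtain ⟨h1, h2⟩ := hω
    by_cases ho : ω ∈ openConn o a₀
    · right
      have hfc : (A.filter fun a => ω ∈ openConn o a) = (A.filter fun a => ω ∈ openConn a₀ a) := by
        refine Finset.filter_congr fun a _ => ?_
        simp only [openConn, Set.mem_setOf_eq] at ho ⊢
        exact ⟨fun h => ho.symm.trans h, fun h => ho.trans h⟩
      show ((A.filter fun a => ω ∈ openConn a₀ a).card : ℝ) < EN / 2
      rw [← hfc]
      exact h2
    · left
      refine ⟨?_, ho⟩
      obtain ⟨a, ha⟩ := Finset.card_pos.1 h1
      rw [Finset.mem_filter] at ha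
      exact Set.mem_biUnion (Finset.mem_coe.2 ha.1) ha.2
  · calc P.real (((⋃ a ∈ A, openConn o a) \ openConn o a₀) ∪ S₁)
        ≤ P.real ((⋃ a ∈ A, openConn o a) \ openConn o a₀) + P.real S₁ := measureReal_union_le _ _
      _ ≤ η + 2 * η := add_le_add hdiff hS₁
      _ ≤ 3 * (P.real (⋃ a ∈ A, openConn o a)ᶜ + η) := by nlinarith

end Summit.CriticalPhenomena.PercolationContinuityZ3.Theorems
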